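import Summits.ValiantsHypothesis.ValiantsHypothesis.Theorems.NewtonUnitEquationsTwoProductsRankOneThreeLawSlice
import HarnessLib

/-!
# Route NewtonUnitEquations — crux `TwoProducts` (stmt-ValiantsHypothesis-5906), line `relation_ladder`, rung R6b (three-term
# rank one, shape `α = β + γ`): the FREE LIFT — `RankOneThreeLaw`, UNCONDITIONAL — part 3/6 — finite SHIFT RANK of the slice functions (Part T5)

(T5) finite shift decompositions `HSD` and their closure properties, shift rank of binomial characters (Vandermonde, val-lit-p3's
`BinExpSum.binChar_add`) and of binomial coefficients of the ADDITIVE form `λ`, hence `Fsl_shift`: `F_b(β + w) = Σ_ι col_β(ι) · ch_ι(w)` with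
`|ι| = 2m(b+1)^3 + 1` — the hypothesis of val-lit-p3's `ShiftRank.pencilCount`.

val-idea-8 g3 (ideator; lens decomp), 2026-08-28. Companion of the R6 module (shape `α + β = γ + δ`, Segre lift). New ingredient: the
relation is INHOMOGENEOUS, so the fibres of the lift `Y_α ↦ Y_β Y_γ` have VARYING letter count and the slice sums are no longer
binomial-exponential sums of bounded width; they carry the extra factor `C(λ(ν) + b - 1 - k, b - k)` with `λ` an ADDITIVE form, which still has
finite SHIFT RANK — so val-lit-p3's general strict-pencil-minimiser count for finite shift rank (`…FormalLogLinearisation.ShiftRank.pencilCount`,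
LANDED p620579) applies BY NAME.

PORT NOTE (val-lit-p3 g15, prover seat, helper mode `--supports stmt-ValiantsHypothesis-5906 --as helper`, no stub credit claimed;
desk RULING #279 (c)): part 3/6 of a VERBATIM Theorems-side port of val-idea-8 g3's sorry-free module
`Cruxes/TwoProducts/Lines/relation_ladder_R6b.lean` (tree @988ccfe3a7f4; file sha256 da7520fdfde8796f…; 1 661 lines; `lean check` rc 0,
0 sorries) into files of ≤ 400 lines, following the R6 port (`…RankOneFourLaw{Toric,Fibres,Slice,Planar,Weights,Count}`, p11 g1 / p3 g14).
ALL mathematics and ALL proofs below are val-idea-8 g3's (engine memo `Cruxes/TwoProducts/Lines/relation_ladder_R6_engine.md` rev 3 §7′,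
card `Lines/relation_ladder.md` v14). The port changes only: (i) the file split and the import chain; (ii) the generic toolkit that the source
re-declares VERBATIM from the R6 module (`phiT/piT` family, `piT_apply`, `ofFun`, `multinomial_univ`, `tab`, `sgn`, `binChar` + lemmas,
`toolBound_mono`, the toric Lemma A `toric_minLog` with `coeff_zero_phiT_lin/coeff_zero_one_add_phiT_lin/phiT_liftG/phiT_logTrunc`,
`RankOneCoincidences`, `rankOneCoincidences_of_permType`, `msetT_apply_eq_zero`, `idxOf`, `enum_idxOf`, `rW`, `lwt_single`, `lwt_piT`) is NOT
re-declared but IMPORTED from the landed R6 port (`…RankOneFourLaw*`, namespace `…PermutationType`, identical texts), so every such name below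
resolves to the landed declaration; (iii) `set_option linter.deprecated false` dropped; (iv) one-line docstrings on API lemmas required by the
tree's docstring lint; (v) in part 6/6 the parameter-free `def RankOneThreeLaw : Prop` is NOT declared (the gate relocates such defs, cf. the R6
port delta p622844) — the law is stated by its LITERAL body as `rankOneThreeLaw_proof`. Namespace = the author's (`…PermutationType.R6b`).
Nothing here closes the line's residual, the crux `TwoProducts` (5906) or `VP ≠ VNP`; no summit statement is proved.

Honest scope (the author's): the shape `2β = α + γ` (R6c) and coincidence rank `≥ 2` (R7) are NOT covered here and go to the residual of
skeleton v15. Nothing here moves VP ≠ VNP; `TwoProducts` (5906) stays OPEN. [folklore]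
-/

noncomputable section

-- Sub = Summit single-conjunct layout: the duplicated namespace component is mandated by the tree.
set_option linter.dupNamespace false
set_option linter.unusedSimpArgs false
set_option linter.unusedSectionVars false

namespace Summit.ValiantsHypothesis.ValiantsHypothesis.Theorems.NewtonUnitEquations.TwoProducts.PermutationType
namespace R6b
open scoped BigOperators
open MvPolynomial

variable {σ : Type*} [Fintype σ] [DecidableEq σ]

variable (I : ThreeIdx σ)

/-! ## Part T5: finite SHIFT RANK of the slice functions (`F(β + w) = Σ_{ι} col_β(ι) · ch_ι(w)`, `|ι| = 2m(b+1)^3 + 1`) — the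
hypothesis of val-lit-p3's `ShiftRank.pencilCount` -/

section ShiftDecomp

/-- A finite shift decomposition of a function on `ℕ^σ`, indexed by `ι`. [folklore] -/
def HSD (ι : Type*) [Fintype ι] (F : (σ → ℕ) → ℂ) : Prop :=
  ∃ (col : (σ → ℕ) → ι → ℂ) (ch : ι → (σ → ℕ) → ℂ), ∀ β w : σ → ℕ, F (β + w) = ∑ i, col β i * ch i w

omit [Fintype σ] [DecidableEq σ] in
/-- Products of finite shift decompositions. [folklore] -/
theorem HSD.mul {ι κ : Type*} [Fintype ι] [Fintype κ] {F G : (σ → ℕ) → ℂ} (hF : HSD ι F) (hG : HSD κ G) :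
    HSD (ι × κ) (fun ν => F ν * G ν) := by
  obtain ⟨col, ch, hF⟩ := hF
  obtain ⟨col', ch', hG⟩ := hG
  refine ⟨fun β p => col β p.1 * col' β p.2, fun p w => ch p.1 w * ch' p.2 w, fun β w => ?_⟩
  simp only [hF, hG, Finset.sum_mul_sum, Fintype.sum_prod_type]
  exact Finset.sum_congr rfl fun i _ => Finset.sum_congr rfl fun k _ => by ring

omit [Fintype σ] [DecidableEq σ] in
/-- A finite shift decomposition times a multiplicative function. [folklore] -/
theorem HSD.mulHom {ι : Type*} [Fintype ι] {F G : (σ → ℕ) → ℂ} (hF : HSD ι F)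
    (hG : ∀ β w : σ → ℕ, G (β + w) = G β * G w) : HSD ι (fun ν => F ν * G ν) := by
  obtain ⟨col, ch, hF⟩ := hF
  refine ⟨fun β i => col β i * G β, fun i w => ch i w * G w, fun β w => ?_⟩
  simp only [hF, hG, Finset.sum_mul]
  exact Finset.sum_congr rfl fun i _ => by ring

omit [Fintype σ] [DecidableEq σ] in
/-- A multiplicative function times a finite shift decomposition. [folklore] -/
theorem HSD.homMul {ι : Type*} [Fintype ι] {F G : (σ → ℕ) → ℂ} (hG : ∀ β w : σ → ℕ, G (β + w) = G β * G w)
    (hF : HSD ι F) : HSD ι (fun ν => G ν * F ν) := by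
  obtain ⟨col, ch, hF⟩ := hF
  refine ⟨fun β i => G β * col β i, fun i w => G w * ch i w, fun β w => ?_⟩
  simp only [hF, hG, Finset.mul_sum]
  exact Finset.sum_congr rfl fun i _ => by ring

omit [Fintype σ] [DecidableEq σ] in
/-- Scalar multiples of finite shift decompositions. [folklore] -/
theorem HSD.constMul {ι : Type*} [Fintype ι] {F : (σ → ℕ) → ℂ} (a : ℂ) (hF : HSD ι F) : HSD ι (fun ν => a * F ν) := by
  obtain ⟨col, ch, hF⟩ := hF
  refine ⟨fun β i => a * col β i, ch, fun β w => ?_⟩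
  simp only [hF, Finset.mul_sum]
  exact Finset.sum_congr rfl fun i _ => by ring

omit [Fintype σ] [DecidableEq σ] in
/-- Finite sums of finite shift decompositions. [folklore] -/
theorem HSD.sum {π ι : Type*} [Fintype π] [Fintype ι] (F : π → (σ → ℕ) → ℂ) (h : ∀ p, HSD ι (F p)) :
    HSD (π × ι) (fun ν => ∑ p, F p ν) := by
  choose col ch hcol using h
  refine ⟨fun β q => col q.1 β q.2, fun q w => ch q.1 q.2 w, fun β w => ?_⟩
  simp only [hcol, Fintype.sum_prod_type]

omit [Fintype σ] [DecidableEq σ] in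
/-- Sums of two finite shift decompositions. [folklore] -/
theorem HSD.add {ι κ : Type*} [Fintype ι] [Fintype κ] {F G : (σ → ℕ) → ℂ} (hF : HSD ι F) (hG : HSD κ G) :
    HSD (ι ⊕ κ) (fun ν => F ν + G ν) := by
  obtain ⟨col, ch, hF⟩ := hF
  obtain ⟨col', ch', hG⟩ := hG
  refine ⟨fun β i => Sum.elim (col β) (col' β) i, fun i w => Sum.elim (fun i => ch i w) (fun k => ch' k w) i,
    fun β w => ?_⟩
  simp only [hF, hG, Fintype.sum_sum_type, Sum.elim_inl, Sum.elim_inr]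

omit [Fintype σ] [DecidableEq σ] in
/-- Binomial characters have shift rank `k + 1` (Vandermonde; val-lit-p3's `BinExpSum.binChar_add`). [folklore] -/
theorem hsd_binChar (t : ℂ) (k b₀ : ℕ) (hk : k ≤ b₀) (i₀ : σ) :
    HSD (Fin (b₀ + 1)) (fun ν : σ → ℕ => binChar t k (ν i₀)) := by
  refine ⟨fun β p => if (p : ℕ) ≤ k then binChar t p (β i₀) else 0, fun p w => binChar t (k - p) (w i₀),
    fun β w => ?_⟩
  have h := Summit.ValiantsHypothesis.ValiantsHypothesis.Theorems.NewtonUnitEquations.TwoProducts.FormalLogLinearisation.BinExpSum.binChar_add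
    t k (β i₀) (w i₀)
  simp only [Pi.add_apply]
  unfold binChar
  rw [h, Fin.sum_univ_eq_sum_range (fun p => (if p ≤ k then ((((β i₀).choose p : ℕ) : ℂ) * t ^ (β i₀ - p)) else 0) *
      ((((w i₀).choose (k - p) : ℕ) : ℂ) * t ^ (w i₀ - (k - p)))) (b₀ + 1)]
  simp_rw [ite_mul, zero_mul]
  rw [← Finset.sum_filter]
  congr 1
  ext p
  simp only [Finset.mem_range, Finset.mem_filter]
  omega

/-- The letter-count form is additive. [folklore] -/
theorem lam_add (β w : σ → ℕ) : lam I (β + w) = lam I β + lam I w := by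
  unfold lam
  simp only [Pi.add_apply, Finset.sum_add_distrib]
  ring

/-- Binomial coefficients of the additive form `λ` have shift rank `d + 1` (Vandermonde). [folklore] -/
theorem hsd_choose (e d b₀ : ℕ) (hd : d ≤ b₀) :
    HSD (Fin (b₀ + 1)) (fun ν : σ → ℕ => (((lam I ν + e).choose d : ℕ) : ℂ)) := by
  refine ⟨fun β p => if (p : ℕ) ≤ d then (((lam I β + e).choose p : ℕ) : ℂ) else 0,
    fun p w => (((lam I w).choose (d - p) : ℕ) : ℂ), fun β w => ?_⟩
  have hnat : (lam I β + e + lam I w).choose d =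
      ∑ p ∈ Finset.range (d + 1), (lam I β + e).choose p * (lam I w).choose (d - p) := by
    have h := Finset.Nat.sum_antidiagonal_eq_sum_range_succ
      (fun p q => (lam I β + e).choose p * (lam I w).choose q) d
    rw [Nat.succ_eq_add_one] at h
    rw [← h, Nat.add_choose_eq]
  simp only
  rw [lam_add, show lam I β + lam I w + e = lam I β + e + lam I w by ring, hnat]
  push_cast
  rw [Fin.sum_univ_eq_sum_range (fun p => (if p ≤ d then (((lam I β + e).choose p : ℕ) : ℂ) else 0) *
      (((lam I w).choose (d - p) : ℕ) : ℂ)) (b₀ + 1)]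
  simp_rw [ite_mul, zero_mul]
  rw [← Finset.sum_filter]
  congr 1
  ext p
  simp only [Finset.mem_range, Finset.mem_filter]
  omega

/-- The rest-product is multiplicative. [folklore] -/
theorem restProd_add (t : σ → ℂ) (β w : σ → ℕ) : restProd I t (β + w) = restProd I t β * restProd I t w := by
  unfold restProd
  rw [← Finset.prod_mul_distrib]
  exact Finset.prod_congr rfl fun j _ => by rw [Pi.add_apply, pow_add]

/-- The slice indicator is multiplicative. [folklore] -/
theorem ind_add (β w : σ → ℕ) : ind I (β + w) = ind I β * ind I w := by
  unfold ind
  simp only [Pi.add_apply]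
  by_cases hβ : β I.a = 0 ∧ β I.c = 0 <;> by_cases hw : w I.a = 0 ∧ w I.c = 0
  · rw [if_pos hβ, if_pos hw, if_pos ⟨by omega, by omega⟩, mul_one]
  · rw [if_pos hβ, if_neg hw, if_neg (fun h => hw ⟨by omega, by omega⟩), mul_zero]
  · rw [if_neg hβ, if_neg (fun h => hβ ⟨by omega, by omega⟩), zero_mul]
  · rw [if_neg hβ, if_neg (fun h => hβ ⟨by omega, by omega⟩), zero_mul]

variable {m : ℕ}

/-- The correction term has shift rank `1`. [folklore] -/
theorem corr_hsd (c d : Fin m → σ → ℂ) (b₀ : ℕ) : HSD Unit (corr I c d b₀) := by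
  refine ⟨fun β _ => corr I c d b₀ β, fun _ w => if (∀ j, w j = 0) then 1 else 0, fun β w => ?_⟩
  rw [Fintype.sum_unique]
  dsimp only
  unfold corr
  by_cases hβ : ∀ j, β j = 0
  · by_cases hw : ∀ j, w j = 0
    · rw [if_pos hw, if_pos hβ, mul_one, if_pos]
      intro j; rw [Pi.add_apply, hβ j, hw j]
    · rw [if_neg hw, mul_zero, if_neg]
      intro h; apply hw; intro j; have := h j; rw [Pi.add_apply] at this; omega
  · rw [if_neg hβ, zero_mul, if_neg]
    intro h; apply hβ; intro j; have := h j; rw [Pi.add_apply] at this; omega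

/-- Each `(j, k)` term has shift rank `≤ (b + 1)^2`. [folklore] -/
theorem mainTerm_hsd (c d : Fin m → σ → ℂ) (b₀ : ℕ) (j : Fin m ⊕ Fin m) (k : ℕ) (hk : k ≤ b₀) :
    HSD (Fin (b₀ + 1) × Fin (b₀ + 1)) (mainTerm I c d b₀ j k) := by
  have h1 := hsd_binChar (σ := σ) (tab c d j I.b) k b₀ hk I.b
  have h2 := h1.mulHom (restProd_add I (tab c d j))
  have h3 := h2.mul (hsd_choose I (b₀ - 1 - k) (b₀ - k) b₀ (by omega))
  unfold mainTerm
  exact h3.constMul _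

/-- The slice index set (`|SIdx m b| = 2 m (b + 1)^3 + 1`). [folklore] -/
abbrev SIdx (m b₀ : ℕ) := ((Fin m ⊕ Fin m) × (Fin (b₀ + 1) × (Fin (b₀ + 1) × Fin (b₀ + 1)))) ⊕ Unit

omit [Fintype σ] [DecidableEq σ] in
/-- The cardinality of the slice index set. [folklore] -/
theorem card_SIdx (m b₀ : ℕ) : Fintype.card (SIdx m b₀) = 2 * m * (b₀ + 1) ^ 3 + 1 := by
  simp only [SIdx, Fintype.card_sum, Fintype.card_prod, Fintype.card_fin, Fintype.card_unit]
  ring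

/-- **Finite shift rank of the slice functions.** [folklore] -/
theorem Fsl_hsd (c d : Fin m → σ → ℂ) (b₀ : ℕ) : HSD (SIdx m b₀) (Fsl I c d b₀) := by
  have hmain : HSD ((Fin m ⊕ Fin m) × (Fin (b₀ + 1) × (Fin (b₀ + 1) × Fin (b₀ + 1))))
      (fun ν => ∑ j : Fin m ⊕ Fin m, ∑ k : Fin (b₀ + 1), mainTerm I c d b₀ j k ν) :=
    HSD.sum _ fun j => HSD.sum (fun (k : Fin (b₀ + 1)) ν => mainTerm I c d b₀ j k ν)
      fun k => mainTerm_hsd I c d b₀ j k (Nat.lt_succ_iff.mp k.isLt)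
  have h := (HSD.homMul (ind_add I) hmain).add (corr_hsd I c d b₀)
  unfold Fsl
  exact h

/-- The shift decomposition, unpacked. [folklore] -/
theorem Fsl_shift (c d : Fin m → σ → ℂ) (b₀ : ℕ) :
    ∃ (col : (σ → ℕ) → SIdx m b₀ → ℂ) (ch : SIdx m b₀ → (σ → ℕ) → ℂ),
      ∀ β w : σ → ℕ, Fsl I c d b₀ (β + w) = ∑ i, col β i * ch i w :=
  Fsl_hsd I c d b₀

end ShiftDecomp

end R6b
end Summit.ValiantsHypothesis.ValiantsHypothesis.Theorems.NewtonUnitEquations.TwoProducts.PermutationType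

end
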